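import Mathlib
import Summits.ResolutionOfSingularities.ResolutionOfSingularities.Theorems.WeightedInvariantLocalWeightedDropNCResRegimePresentedAssemblyB
import Summits.ResolutionOfSingularities.ResolutionOfSingularities.Theorems.WeightedInvariantLocalWeightedDropNCResRegimeLetterAssembly

/-!
# `WeightedInvariant.LocalWeightedDrop` ENGINE, W′|₄ line — D₃ᴮ object (2c): REGIME (L) «LETTER DIRECTRIX» IN B-PERMISSIBLE FORM, FROM THE (P)-PIECES

Sub-problem `ResolutionOfSingularities`, ENGINE crux `stmt-ResolutionOfSingularities-8899` (`LocalWeightedDrop`), registered stub W′|₄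
`stub_wildWideApexFourStartsWon`; res-L1-w43-plan-1 RULING 2026-08-27T21:45:42Z (D₃ᴮ lane (b)(2)); the hypothesis `hL_B` of `surfaceBoundaryNC_of_regimesB`
(…NCResPhaseAssemblyB p579166).  [OURS · L1 W4.3 · chain w43 · res-L1-w43-lead-1 g6; def-free; the proof of `regimeLetter_of_pieces` (…NCResRegimeLetterAssembly,
lead-1 g5) re-threaded over `DBWinsTo` (p575221); nothing here is a statement of any manuscript; AI-produced, gate-checked, weaker than expert review.]

DEVICE (as in the `DWinsTo` proof): FOLD the letter into the history, `δ⁺ = (f, E, {l})`, play regime (P)'s one-step pieces on the folded line, and READ every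
state through the UNFOLD `U ε = (ε.f, ε.E, ∅)` (at the order of the phase; `U ε = ε` once the order dropped).  What is new in B-form: the successor must be
THE TRANSFORM of the unfolded decoration — and indeed `(U ε).transform Φ w c i = U (ε.transform Φ w c i)` whenever the successor's order did not rise
(both branches of `Decoration.transform` read `f` and `E` only, and the history branch reads `O` through `newLetters`, empty on `∅`), while a move
B-permissible for `ε` is B-permissible for `U ε` (the O-condition only shrinks).
* `DBWinsTo.of_measure_readings` — measure form with recordings READ through a state map (generalises `of_measure_labels`);
* **`regimeLetterB_of_pieces`** — `hL_B` from the pieces of `regimePresentedB_of_pieces` (one-steps in B-form, with the `o`-drop disjunct).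
-/

set_option linter.dupNamespace false -- mandated namespace of this single-conjunct summit

noncomputable section

namespace Summit.ResolutionOfSingularities.ResolutionOfSingularities.Theorems

namespace TameFourTupleDrop

open MvPowerSeries Literature.AlgebraicGeometry.Resolution PolyDescent

variable {k : Type} [Field k] {m : ℕ}

/-! ## Measure form with recordings read through a state map -/

/-- **MEASURE FORM WITH READ RECORDINGS.**  `C` a set of recordings `(τ, ℓ)` of PRE-states, `rd` a reading of pre-states as states, `μ` a measure on
recordings: if from every recording whose read state is not in the target some move B-permissible FOR THE READ STATE has, at every answer, the transform OF
THE READ STATE in the target or equal to the reading of a recorded pre-state of smaller measure, then every read recorded state B-wins towards the target. -/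
theorem DBWinsTo.of_measure_readings {L : Type} {Q : MvPowerSeries (Fin (m + 1)) k × Decoration k m → Prop}
    (rd : MvPowerSeries (Fin (m + 1)) k × Decoration k m → MvPowerSeries (Fin (m + 1)) k × Decoration k m)
    (C : Set ((MvPowerSeries (Fin (m + 1)) k × Decoration k m) × L)) (μ : (MvPowerSeries (Fin (m + 1)) k × Decoration k m) × L → Ordinal.{0})
    (hstep : ∀ σ ∈ C, ¬ Q (rd σ.1) → ∃ (Φ : Fin (m + 1) → MvPowerSeries (Fin (m + 1)) k) (w : Fin (m + 1) → ℕ),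
      IsBPermissible (rd σ.1).2 Φ w ∧ BMoveClause (rd σ.1) Φ w
        (fun υ' => Q υ' ∨ ∃ (τ' : MvPowerSeries (Fin (m + 1)) k × Decoration k m) (ℓ' : L), rd τ' = υ' ∧ (τ', ℓ') ∈ C ∧ μ (τ', ℓ') < μ σ))
    {σ : (MvPowerSeries (Fin (m + 1)) k × Decoration k m) × L} (hσ : σ ∈ C) : DBWinsTo Q (rd σ.1) := by
  classical
  let R : Set (MvPowerSeries (Fin (m + 1)) k × Decoration k m) := {υ | ∃ (τ : MvPowerSeries (Fin (m + 1)) k × Decoration k m) (ℓ : L), rd τ = υ ∧ (τ, ℓ) ∈ C}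
  let val : MvPowerSeries (Fin (m + 1)) k × Decoration k m → Ordinal.{0} := fun υ =>
    sInf {α | ∃ (τ : MvPowerSeries (Fin (m + 1)) k × Decoration k m) (ℓ : L), rd τ = υ ∧ (τ, ℓ) ∈ C ∧ μ (τ, ℓ) = α}
  have hval : ∀ υ ∈ R, ∃ (τ : MvPowerSeries (Fin (m + 1)) k × Decoration k m) (ℓ : L), rd τ = υ ∧ (τ, ℓ) ∈ C ∧ μ (τ, ℓ) = val υ := by
    rintro υ ⟨τ, ℓ, hrd, hℓ⟩
    have hne : {α | ∃ (τ : MvPowerSeries (Fin (m + 1)) k × Decoration k m) (ℓ : L), rd τ = υ ∧ (τ, ℓ) ∈ C ∧ μ (τ, ℓ) = α}.Nonempty :=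
      ⟨_, τ, ℓ, hrd, hℓ, rfl⟩
    exact csInf_mem hne
  have hval_le : ∀ (τ : MvPowerSeries (Fin (m + 1)) k × Decoration k m) (ℓ : L), (τ, ℓ) ∈ C → val (rd τ) ≤ μ (τ, ℓ) :=
    fun τ ℓ h => csInf_le' ⟨τ, ℓ, rfl, h, rfl⟩
  refine ⟨R ∪ {υ | Q υ}, fun υ => if Q υ then 0 else val υ + 1, ?_, Or.inl ⟨σ.1, σ.2, rfl, by cases σ; exact hσ⟩⟩
  intro υ hυ hQ
  have hυR : υ ∈ R := hυ.resolve_right hQ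
  obtain ⟨τ, ℓ, hrd, hℓC, hℓμ⟩ := hval υ hυR
  subst hrd
  obtain ⟨Φ, w, hmv, hcl⟩ := hstep (τ, ℓ) hℓC hQ
  refine ⟨Φ, w, hmv, hcl.mono fun υ' hυ' => ?_⟩
  rcases hυ' with hq | ⟨τ', ℓ', hrd', hC', hlt⟩
  · refine ⟨Or.inr hq, ?_⟩
    show (if Q υ' then (0 : Ordinal.{0}) else val υ' + 1) < (if Q (rd τ) then 0 else val (rd τ) + 1)
    rw [if_pos hq, if_neg hQ]
    exact Order.lt_add_one_iff.mpr bot_le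
  · refine ⟨Or.inl ⟨τ', ℓ', hrd', hC'⟩, ?_⟩
    show (if Q υ' then (0 : Ordinal.{0}) else val υ' + 1) < (if Q (rd τ) then 0 else val (rd τ) + 1)
    rw [if_neg hQ]
    split_ifs
    · exact Order.lt_add_one_iff.mpr bot_le
    · rw [hℓμ] at hlt
      rw [← hrd']
      exact Order.lt_add_one_iff.mpr (Order.add_one_le_of_lt (lt_of_le_of_lt (hval_le τ' ℓ' hC') hlt))

/-! ## Regime (L) in B-form -/

/-- **REGIME (L), B-PERMISSIBLE FORM, FROM THE PIECES OF REGIME (P).**  From every admissibly decorated position with `2 ≤ o`, empty history and a letter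
directrix `in_o f = λ · x_l^o`, the mover B-FORCES (B-permissible moves, TRANSFORM successors) an admissible position of smaller head, or of the same head in the
apex column, in good position or in bad position.  Pieces: as `regimePresentedB_of_pieces`, the one-steps with the `o`-drop disjunct (the shape of
res-L1-w43-stub-2's `exists_move_of_not_conflict` / `exists_move_point` in B-form). -/
theorem regimeLetterB_of_pieces [Infinite k]
    (ψsel : (d : ℕ) → (Fin d → MvPowerSeries (Fin 2) k) → MvPowerSeries (Fin 2) k)
    (hsel : ∀ (d : ℕ) (X : Fin d → MvPowerSeries (Fin 2) k), IsPosT d X → IsPrepRecentring d X (ψsel d X))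
    (M : (d : ℕ) → (Fin d → MvPowerSeries (Fin 2) k) → Finset (Fin 2) → ℕ)
    (hM_succ : ∀ (d : ℕ) (A : Fin d → MvPowerSeries (Fin 2) k) (N : Finset (Fin 2)) (A' : Fin d → MvPowerSeries (Fin 2) k)
      (N' : Finset (Fin 2)),
      (∃ (b : MvPowerSeries (Fin (2 + 1)) k) (δ : Decoration k 2) (Θ : Fin (2 + 1) → MvPowerSeries (Fin (2 + 1)) k),
        Admissible b δ ∧ 2 ≤ δ.o ∧ δ.c = d ∧ δ.PresBy d A N Θ) →
      InPoly d A → InPoly d A' → SuccFamilySel d (ψsel d) A N A' N' → M d A' N' ≤ M d A N)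
    (hM_conf : ∀ (d : ℕ) (A : Fin d → MvPowerSeries (Fin 2) k) (N : Finset (Fin 2)) (A' : Fin d → MvPowerSeries (Fin 2) k)
      (N' : Finset (Fin 2)),
      (∃ (b : MvPowerSeries (Fin (2 + 1)) k) (δ : Decoration k 2) (Θ : Fin (2 + 1) → MvPowerSeries (Fin (2 + 1)) k),
        Admissible b δ ∧ 2 ≤ δ.o ∧ δ.c = d ∧ δ.PresBy d A N Θ) →
      InPoly d A → InPoly d A' → NCPoly.Conflict d A N → PointFamilySel d (ψsel d) A N A' N' → M d A' N' < M d A N)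
    (hP1 : ∀ (b : MvPowerSeries (Fin (2 + 1)) k) (δ : Decoration k 2), Admissible b δ → 2 ≤ δ.o → ¬ δ.HCol →
      (δ.O.Nonempty ∨ δ.GoodDir) →
      ∃ (A : Fin δ.c → MvPowerSeries (Fin 2) k) (N : Finset (Fin 2)) (Θ : Fin (2 + 1) → MvPowerSeries (Fin (2 + 1)) k),
        δ.PresBy δ.c A N Θ ∧ InPoly δ.c A)
    (hPx : ∀ (b : MvPowerSeries (Fin (2 + 1)) k) (δ : Decoration k 2) (d : ℕ) (A : Fin d → MvPowerSeries (Fin 2) k) (N : Finset (Fin 2))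
      (Θ : Fin (2 + 1) → MvPowerSeries (Fin (2 + 1)) k),
      Admissible b δ → 2 ≤ δ.o → δ.c = d → δ.PresBy d A N Θ → WellPrepared d A → ¬ InPoly d A → δ.HCol)
    (hP2' : ∀ (b : MvPowerSeries (Fin (2 + 1)) k) (δ : Decoration k 2) (d : ℕ) (A : Fin d → MvPowerSeries (Fin 2) k) (N : Finset (Fin 2))
      (Θ : Fin (2 + 1) → MvPowerSeries (Fin (2 + 1)) k),
      Admissible b δ → 2 ≤ δ.o → δ.c = d → δ.PresBy d A N Θ → InPoly d A → ¬ NCPoly.Conflict d A N →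
      ∃ (Φ : Fin (2 + 1) → MvPowerSeries (Fin (2 + 1)) k) (w : Fin (2 + 1) → ℕ), IsBPermissible δ Φ w ∧
        BMoveClause (b, δ) Φ w (fun τ' => Admissible τ'.1 τ'.2 ∧ (τ'.2.o < δ.o ∨ (τ'.2.head = δ.head ∧
          ∃ (A' : Fin d → MvPowerSeries (Fin 2) k) (N' : Finset (Fin 2)) (Θ' : Fin (2 + 1) → MvPowerSeries (Fin (2 + 1)) k),
            τ'.2.PresBy d A' N' Θ' ∧ WellPrepared d A' ∧ SuccFamilySel d (ψsel d) A N A' N'))))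
    (hP2c' : ∀ (b : MvPowerSeries (Fin (2 + 1)) k) (δ : Decoration k 2) (d : ℕ) (A : Fin d → MvPowerSeries (Fin 2) k) (N : Finset (Fin 2))
      (Θ : Fin (2 + 1) → MvPowerSeries (Fin (2 + 1)) k),
      Admissible b δ → 2 ≤ δ.o → δ.c = d → δ.PresBy d A N Θ → InPoly d A → NCPoly.Conflict d A N →
      ∃ (Φ : Fin (2 + 1) → MvPowerSeries (Fin (2 + 1)) k) (w : Fin (2 + 1) → ℕ), IsBPermissible δ Φ w ∧
        BMoveClause (b, δ) Φ w (fun τ' => Admissible τ'.1 τ'.2 ∧ (τ'.2.o < δ.o ∨ (τ'.2.head = δ.head ∧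
          ∃ (A' : Fin d → MvPowerSeries (Fin 2) k) (N' : Finset (Fin 2)) (Θ' : Fin (2 + 1) → MvPowerSeries (Fin (2 + 1)) k),
            τ'.2.PresBy d A' N' Θ' ∧ WellPrepared d A' ∧ PointFamilySel d (ψsel d) A N A' N'))))
    (b : MvPowerSeries (Fin (2 + 1)) k) (δ : Decoration k 2) (hadm : Admissible b δ) (ho : 2 ≤ δ.o) {l : Fin (2 + 1)} (hl : δ.LetterDir l) :
    DBWinsTo (fun τ : MvPowerSeries (Fin (2 + 1)) k × Decoration k 2 =>
      Admissible τ.1 τ.2 ∧ (τ.2.head < δ.head ∨ (τ.2.head = δ.head ∧ (τ.2.HCol ∨ τ.2.GoodDir ∨ τ.2.BadDir)))) (b, δ) := by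
  classical
  obtain ⟨hO, hlE, hdir⟩ := hl
  -- THE FOLD `δ⁺ = (f, E, {l})`
  let δp : Decoration k 2 := ⟨δ.f, δ.E, {l}, Finset.singleton_subset_iff.mpr hlE⟩
  have hδpo : δp.o = δ.o := rfl
  have hδpc : δp.c = δ.o + 1 := by
    have h1 : δp.c = δp.o + δp.O.card := rfl
    have h2 : δp.O.card = 1 := Finset.card_singleton l
    rw [h1, h2, hδpo]
  have hδc : δ.c = δ.o := Decoration.c_eq_o_of_O_eq_empty hO
  have hadmp : Admissible b δp := hadm
  have hdirp : δp.IsDirForm (Pi.single l 1) := by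
    obtain ⟨hℓ0, la, hla, hcone⟩ := hdir
    rw [hδc, hO, Finset.prod_empty, mul_one] at hcone
    refine ⟨hℓ0, la, hla, fun v => ?_⟩
    show CobordantChart.initEval (fun _ : Fin (2 + 1) => 1) v δp.c (δ.f * ∏ l' ∈ ({l} : Finset (Fin (2 + 1))), X l') = _
    rw [hδpc, Finset.prod_singleton, TOT2Near.initEval_mul_X, hcone, single_one_dotProduct, pow_succ, mul_assoc]
  have hncp : ¬ δp.HCol := Decoration.not_hCol_of_isDirForm hdirp
  have hnep : δp.O.Nonempty := ⟨l, Finset.mem_singleton_self l⟩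
  set d : ℕ := δp.c with hd_def
  have hd : 0 < d := by omega
  obtain ⟨A₀, N₀, Θ₀, hpres₀, hin₀⟩ := hP1 b δp hadmp (hδpo ▸ ho) hncp (Or.inl hnep)
  -- THE UNFOLD
  let U : Decoration k 2 → Decoration k 2 := fun ε =>
    if ε.o = δ.o then ⟨ε.f, ε.E, ∅, Finset.empty_subset _⟩ else ε
  have hUeq : ∀ ε : Decoration k 2, ε.o = δ.o → (U ε).f = ε.f ∧ (U ε).E = ε.E ∧ (U ε).O = ∅ := fun ε h => by
    refine ⟨?_, ?_, ?_⟩ <;> simp only [U, if_pos h]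
  have hUlt : ∀ ε : Decoration k 2, ε.o ≠ δ.o → U ε = ε := fun ε h => by simp only [U, if_neg h]
  have hUadm : ∀ (b' : MvPowerSeries (Fin (2 + 1)) k) (ε : Decoration k 2), Admissible b' ε → Admissible b' (U ε) := by
    intro b' ε hε
    by_cases h : ε.o = δ.o
    · obtain ⟨hf, hE, -⟩ := hUeq ε h
      obtain ⟨h1, h2, h3⟩ := hε
      refine ⟨?_, ?_, ?_⟩
      · simpa [Decoration.total, hf, hE] using h1
      · rw [hf]; exact h2
      · rw [hf, hE]; exact h3
    · rw [hUlt ε h]; exact hε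
  have hU0 : U δp = δ := by
    obtain ⟨hf, hE, hO'⟩ := hUeq δp hδpo
    exact Decoration.eq_of_parts hf hE (hO'.trans hO.symm)
  -- a move B-permissible for `ε` is B-permissible for `U ε` (the O-condition shrinks)
  have hUperm : ∀ (ε : Decoration k 2) (Φ : Fin (2 + 1) → MvPowerSeries (Fin (2 + 1)) k) (w : Fin (2 + 1) → ℕ),
      IsBPermissible ε Φ w → IsBPermissible (U ε) Φ w := by
    intro ε Φ w h
    by_cases hε : ε.o = δ.o
    · have hU : U ε = ⟨ε.f, ε.E, ∅, Finset.empty_subset _⟩ := by simp only [U, if_pos hε]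
      rw [hU]
      exact ⟨h.1, h.2.1, fun l' hl' => absurd hl' (Finset.notMem_empty l'), h.2.2.2⟩
    · rw [hUlt ε hε]; exact h
  -- the transform of the unfold is the unfold of the transform (when the order did not rise)
  have hUtr : ∀ (ε : Decoration k 2) (Φ : Fin (2 + 1) → MvPowerSeries (Fin (2 + 1)) k) (w : Fin (2 + 1) → ℕ) (c : Fin (2 + 1) → k)
      (i : Fin (2 + 1)), ε.o = δ.o → ((ε.transform Φ w c i).o < δ.o ∨ (ε.transform Φ w c i).head = ε.head) →
      (U ε).transform Φ w c i = U (ε.transform Φ w c i) := by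
    intro ε Φ w c i hε hsucc
    have hU : U ε = ⟨ε.f, ε.E, ∅, Finset.empty_subset _⟩ := by simp only [U, if_pos hε]
    have hstr : (U ε).strict Φ w c i = ε.strict Φ w c i := by rw [hU]; rfl
    have hf' : ((U ε).transform Φ w c i).f = (ε.transform Φ w c i).f := by
      rw [Decoration.transform_f, Decoration.transform_f, hstr]
    have hE' : ((U ε).transform Φ w c i).E = (ε.transform Φ w c i).E := by
      rw [Decoration.transform_E, Decoration.transform_E, hU]
    have ho' : (ε.transform Φ w c i).o = ((sqfRep (ε.strict Φ w c i)).order).toNat := Decoration.transform_o ε Φ w c i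
    have hoU : (U ε).o = ε.o := by rw [hU]; rfl
    by_cases hlt : ((sqfRep (ε.strict Φ w c i)).order).toNat < ε.o
    · -- order dropped: both histories are reset, `U` is the identity on the successor
      have hlt' : (ε.transform Φ w c i).o < δ.o := by rw [ho', ← hε]; exact hlt
      rw [hUlt _ hlt'.ne]
      refine Decoration.eq_of_parts hf' hE' ?_
      rw [Decoration.transform_O_of_lt ε Φ w c i hlt, Decoration.transform_O_of_lt (U ε) Φ w c i (by rw [hstr, hoU]; exact hlt), hU]
    · -- order kept: the successor has the order of the phase, its unfold has empty history
      have hge : (ε.transform Φ w c i).o = δ.o := by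
        rcases hsucc with h | h
        · exact absurd (by rw [ho', ← hε] at h; exact h) hlt
        · rw [Decoration.head, Decoration.head, toLex_inj, Prod.ext_iff] at h
          exact h.1.trans hε
      obtain ⟨hf2, hE2, hO2⟩ := hUeq _ hge
      refine Decoration.eq_of_parts (hf'.trans hf2.symm) (hE'.trans hE2.symm) ?_
      rw [hO2, Decoration.transform_O_of_not_lt (U ε) Φ w c i (by rw [hstr, hoU]; exact hlt), hU]
      simp [Decoration.newLetters]
  -- recordings, target, region, measure
  let L : Type := (Fin d → MvPowerSeries (Fin 2) k) × Finset (Fin 2)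
  let rd : MvPowerSeries (Fin (2 + 1)) k × Decoration k 2 → MvPowerSeries (Fin (2 + 1)) k × Decoration k 2 := fun τ => (τ.1, U τ.2)
  let Q : MvPowerSeries (Fin (2 + 1)) k × Decoration k 2 → Prop := fun υ =>
    Admissible υ.1 υ.2 ∧ (υ.2.head < δ.head ∨ (υ.2.head = δ.head ∧ (υ.2.HCol ∨ υ.2.GoodDir ∨ υ.2.BadDir)))
  let C : Set ((MvPowerSeries (Fin (2 + 1)) k × Decoration k 2) × L) := {σ | Admissible σ.1.1 σ.1.2 ∧ σ.1.2.head = δp.head ∧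
    (∃ Θ : Fin (2 + 1) → MvPowerSeries (Fin (2 + 1)) k, σ.1.2.PresBy d σ.2.1 σ.2.2 Θ) ∧ InPoly d σ.2.1}
  let rk : (Fin d → MvPowerSeries (Fin 2) k) → Ordinal.{0} := fun A => ((wellFounded_polyRelSel (k := k) hd (hsel d)).apply A).rank
  let Λ : Ordinal.{0} := (⨆ A, rk A) + 1
  have hΛ : ∀ A, rk A < Λ := fun A => Order.lt_add_one_iff.mpr (le_ciSup (Ordinal.bddAbove_of_small (s := Set.range rk)) A)
  let μ : (MvPowerSeries (Fin (2 + 1)) k × Decoration k 2) × L → Ordinal.{0} := fun σ => Λ * (M d σ.2.1 σ.2.2 : Ordinal.{0}) + rk σ.2.1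
  have hlex : ∀ (n n' : ℕ) (A A' : Fin d → MvPowerSeries (Fin 2) k), n' < n ∨ (n' = n ∧ rk A' < rk A) →
      Λ * (n' : Ordinal.{0}) + rk A' < Λ * (n : Ordinal.{0}) + rk A := by
    rintro n n' A A' (hn | ⟨rfl, hr⟩)
    · have hn' : ((n' + 1 : ℕ) : Ordinal.{0}) ≤ (n : Ordinal.{0}) := Nat.cast_le.mpr (Nat.succ_le_of_lt hn)
      calc Λ * (n' : Ordinal.{0}) + rk A' < Λ * (n' : Ordinal.{0}) + Λ := by
            gcongr
            exact hΛ A'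
        _ = Λ * ((n' + 1 : ℕ) : Ordinal.{0}) := by rw [Nat.cast_succ, mul_add_one]
        _ ≤ Λ * (n : Ordinal.{0}) := by gcongr
        _ ≤ Λ * (n : Ordinal.{0}) + rk A := le_self_add
    · gcongr
  have hoc : ∀ ε : Decoration k 2, ε.head = δp.head → ε.o = δ.o ∧ ε.c = d := by
    intro ε h
    rw [Decoration.head, Decoration.head, toLex_inj, Prod.ext_iff] at h
    exact ⟨h.1.trans hδpo, h.2⟩
  have hOone : ∀ ε : Decoration k 2, ε.head = δp.head → ∃ l', ε.O = {l'} := by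
    intro ε h
    obtain ⟨hoε, hcε⟩ := hoc ε h
    have hcard : ε.O.card = 1 := by
      have h1 : ε.c = ε.o + ε.O.card := rfl
      omega
    exact Finset.card_eq_one.mp hcard
  -- exits read through the unfold
  have hQ_of_lt : ∀ (b' : MvPowerSeries (Fin (2 + 1)) k) (ε : Decoration k 2), Admissible b' ε → ε.o < δ.o → Q (b', U ε) := by
    intro b' ε hε hlt
    refine ⟨hUadm b' ε hε, Or.inl ?_⟩
    show (U ε).head < δ.head
    rw [hUlt ε hlt.ne, Decoration.head, Decoration.head, Prod.Lex.toLex_lt_toLex]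
    exact Or.inl hlt
  have hQ_of_exit : ∀ (b' : MvPowerSeries (Fin (2 + 1)) k) (ε : Decoration k 2), Admissible b' ε → ε.head = δp.head →
      ∀ (A' : Fin d → MvPowerSeries (Fin 2) k) (N' : Finset (Fin 2)) (Θ' : Fin (2 + 1) → MvPowerSeries (Fin (2 + 1)) k),
      ε.PresBy d A' N' Θ' → WellPrepared d A' → ¬ InPoly d A' → Q (b', U ε) := by
    intro b' ε hε hhead A' N' Θ' hpres hWP hnin
    obtain ⟨hoε, hcε⟩ := hoc ε hhead
    have hoε2 : 2 ≤ ε.o := by rw [hoε]; exact ho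
    have hcolε : ε.HCol := hPx b' ε d A' N' Θ' hε hoε2 hcε hpres hWP hnin
    obtain ⟨l', hOl'⟩ := hOone ε hhead
    obtain ⟨hf, hE, hO'⟩ := hUeq ε hoε
    have hUo : (U ε).o = δ.o := by rw [Decoration.o, hf, show (ε.f.order).toNat = ε.o from rfl, hoε]
    have hUc : (U ε).c = δ.o := by rw [Decoration.c, hO', Finset.card_empty, add_zero, hUo]
    refine ⟨hUadm b' ε hε, Or.inr ⟨?_, ?_⟩⟩
    · show (U ε).head = δ.head
      rw [Decoration.head, Decoration.head, hUo, hUc, hδc]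
    · exact Decoration.hCol_or_goodDir_or_badDir_unfold hε hoε2 hOl' hcε hpres hcolε hf hE hO'
  have hσ₀ : (((b, δp), (A₀, N₀)) : (MvPowerSeries (Fin (2 + 1)) k × Decoration k 2) × L) ∈ C := ⟨hadmp, rfl, ⟨Θ₀, hpres₀⟩, hin₀⟩
  have hwin := DBWinsTo.of_measure_readings (Q := Q) rd C μ ?_ hσ₀
  · have h0 : rd (b, δp) = (b, δ) := by show (b, U δp) = (b, δ); rw [hU0]
    rw [h0] at hwin
    exact hwin
  rintro ⟨⟨b₁, ε₁⟩, ⟨A₁, N₁⟩⟩ ⟨hadm₁, hhead₁, ⟨Θ₁, hpres₁⟩, hin₁⟩ -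
  obtain ⟨ho₁, hc₁⟩ := hoc ε₁ hhead₁
  have ho₁' : 2 ≤ ε₁.o := by rw [ho₁]; exact ho
  have hctx : ∃ (b : MvPowerSeries (Fin (2 + 1)) k) (δ : Decoration k 2) (Θ : Fin (2 + 1) → MvPowerSeries (Fin (2 + 1)) k),
      Admissible b δ ∧ 2 ≤ δ.o ∧ δ.c = d ∧ δ.PresBy d A₁ N₁ Θ := ⟨b₁, ε₁, Θ₁, hadm₁, ho₁', hc₁, hpres₁⟩
  -- reading a same-head successor of the folded line
  have hread : ∀ (τ' : MvPowerSeries (Fin (2 + 1)) k × Decoration k 2), Admissible τ'.1 τ'.2 → τ'.2.head = δp.head →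
      ∀ (A' : Fin d → MvPowerSeries (Fin 2) k) (N' : Finset (Fin 2)) (Θ' : Fin (2 + 1) → MvPowerSeries (Fin (2 + 1)) k),
      τ'.2.PresBy d A' N' Θ' → WellPrepared d A' →
      (M d A' N' < M d A₁ N₁ ∨ (M d A' N' = M d A₁ N₁ ∧ rk A' < rk A₁) ∨ ¬ InPoly d A') →
      Q (rd τ') ∨ ∃ (τ'' : MvPowerSeries (Fin (2 + 1)) k × Decoration k 2) (ℓ' : L), rd τ'' = rd τ' ∧ (τ'', ℓ') ∈ C ∧
        μ (τ'', ℓ') < μ ((b₁, ε₁), (A₁, N₁)) := by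
    intro τ' hadm' hhead' A' N' Θ' hpres' hWP' halt
    by_cases hin' : InPoly d A'
    · rcases halt with hlt | hlt | hnin
      · exact Or.inr ⟨τ', (A', N'), rfl, ⟨hadm', hhead', ⟨Θ', hpres'⟩, hin'⟩, hlex _ _ _ _ (Or.inl hlt)⟩
      · exact Or.inr ⟨τ', (A', N'), rfl, ⟨hadm', hhead', ⟨Θ', hpres'⟩, hin'⟩, hlex _ _ _ _ (Or.inr hlt)⟩
      · exact absurd hin' hnin
    · exact Or.inl (hQ_of_exit τ'.1 τ'.2 hadm' hhead' A' N' Θ' hpres' hWP' hin')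
  -- the B-move on the unfolded line from the folded one-step
  have hlift : ∀ (Φ : Fin (2 + 1) → MvPowerSeries (Fin (2 + 1)) k) (w : Fin (2 + 1) → ℕ) (fam : (Fin d → MvPowerSeries (Fin 2) k) →
      Finset (Fin 2) → Prop),
      (∀ A' N', fam A' N' → InPoly d A' → M d A' N' < M d A₁ N₁ ∨ (M d A' N' = M d A₁ N₁ ∧ rk A' < rk A₁)) →
      IsBPermissible ε₁ Φ w →
      BMoveClause (b₁, ε₁) Φ w (fun τ' => Admissible τ'.1 τ'.2 ∧ (τ'.2.o < ε₁.o ∨ (τ'.2.head = ε₁.head ∧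
        ∃ (A' : Fin d → MvPowerSeries (Fin 2) k) (N' : Finset (Fin 2)) (Θ' : Fin (2 + 1) → MvPowerSeries (Fin (2 + 1)) k),
          τ'.2.PresBy d A' N' Θ' ∧ WellPrepared d A' ∧ fam A' N'))) →
      IsBPermissible (rd (b₁, ε₁)).2 Φ w ∧ BMoveClause (rd (b₁, ε₁)) Φ w
        (fun υ' => Q υ' ∨ ∃ (τ' : MvPowerSeries (Fin (2 + 1)) k × Decoration k 2) (ℓ' : L), rd τ' = υ' ∧ (τ', ℓ') ∈ C ∧
          μ (τ', ℓ') < μ ((b₁, ε₁), (A₁, N₁))) := by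
    intro Φ w fam hfam hperm hcl
    refine ⟨hUperm ε₁ Φ w hperm, ?_⟩
    intro c hc hc0 Aexp G hG hX
    obtain ⟨i, hci, hadm', hcase⟩ := hcl c hc hc0 Aexp G hG hX
    refine ⟨i, hci, ?_⟩
    have hsucc : (ε₁.transform Φ w c i).o < δ.o ∨ (ε₁.transform Φ w c i).head = ε₁.head := by
      rcases hcase with h | ⟨h, -⟩
      · exact Or.inl (ho₁ ▸ h)
      · exact Or.inr h
    have htr : (U ε₁).transform Φ w c i = U (ε₁.transform Φ w c i) := hUtr ε₁ Φ w c i ho₁ hsucc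
    show Q (X 0 * TupleGame.slice i G, (U ε₁).transform Φ w c i) ∨ _
    rw [htr]
    rcases hcase with hlt | ⟨hhead', A', N', Θ', hpres', hWP', hf'⟩
    · exact Or.inl (hQ_of_lt _ _ hadm' (ho₁ ▸ hlt))
    · have halt : M d A' N' < M d A₁ N₁ ∨ (M d A' N' = M d A₁ N₁ ∧ rk A' < rk A₁) ∨ ¬ InPoly d A' := by
        by_cases hin' : InPoly d A'
        · rcases hfam A' N' hf' hin' with h | h
          · exact Or.inl h
          · exact Or.inr (Or.inl h)
        · exact Or.inr (Or.inr hin')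
      rcases hread (X 0 * TupleGame.slice i G, ε₁.transform Φ w c i) hadm' (hhead'.trans hhead₁) A' N' Θ' hpres' hWP' halt with hq | ⟨τ'', ℓ', hrd, hC, hμ⟩
      · exact Or.inl hq
      · exact Or.inr ⟨τ'', ℓ', hrd, hC, hμ⟩
  by_cases hconf : NCPoly.Conflict d A₁ N₁
  · obtain ⟨Φ, w, hperm, hcl⟩ := hP2c' b₁ ε₁ d A₁ N₁ Θ₁ hadm₁ ho₁' hc₁ hpres₁ hin₁ hconf
    exact ⟨Φ, w, hlift Φ w (fun A' N' => PointFamilySel d (ψsel d) A₁ N₁ A' N')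
      (fun A' N' hf' hin' => Or.inl (hM_conf d A₁ N₁ A' N' hctx hin₁ hin' hconf hf')) hperm hcl⟩
  · obtain ⟨Φ, w, hperm, hcl⟩ := hP2' b₁ ε₁ d A₁ N₁ Θ₁ hadm₁ ho₁' hc₁ hpres₁ hin₁ hconf
    refine ⟨Φ, w, hlift Φ w (fun A' N' => SuccFamilySel d (ψsel d) A₁ N₁ A' N') (fun A' N' hf' hin' => ?_) hperm hcl⟩
    have hM := hM_succ d A₁ N₁ A' N' hctx hin₁ hin' hf'
    have hrel : PolyRelSel d (ψsel d) A' A₁ := ⟨mem_succTSel_of_succFamilySel hf', hin₁, hin'⟩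
    have hrk : rk A' < rk A₁ := ((wellFounded_polyRelSel (k := k) hd (hsel d)).apply A₁).rank_lt_of_rel hrel
    rcases hM.lt_or_eq with hMlt | hMeq
    · exact Or.inl hMlt
    · exact Or.inr ⟨hMeq, hrk⟩

end TameFourTupleDrop

end Summit.ResolutionOfSingularities.ResolutionOfSingularities.Theorems

end
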